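import Literature.NumberTheory.LFunctions.RobinAnalyticRH
import Literature.NumberTheory.LFunctions.RobinCABelow
import HarnessLib

/-!
# Robin's criterion and Lagarias's criterion hold: `robin_iff_holds`, `lagarias_iff_holds`

Topic: `Literature/NumberTheory/LFunctions`. THEOREMS (pure proof file, nothing asserted). Discharge of
the named facts `Literature.NumberTheory.LFunctions.robin_iff` (G. Robin 1984, Thm. 1 with §4 Prop. 1:
`RH ⟺ σ(n) < e^γ n log log n` for all `n > 5040`) and `Literature.NumberTheory.LFunctions.lagarias_iff`
(J. C. Lagarias 2002, Thm. 1.1: `RH ⟺ σ(n) ≤ H_n + exp(H_n) log(H_n)` for all `n ≥ 1`), both stated in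
`RHClassicalEquivalents.lean`.

Assembly (`RH ⟹` direction; the converse directions are the tree's `Nicolas1983_logf_omega_holds`,
`robinInequality_imp_riemannHypothesis_of_nicolas`, `Robin1984_sigma_oscillation_holds`):

* `Robin1984_thm1_colossallyAbundant_holds` — Robin's inequality at every colossally abundant `N > 5040`
  under RH: for the largest prime `P < 4¹¹` by the kernel-certified run over the colossally abundant chain
  (`robinCA_below_four_pow_eleven`, `RobinCABelow.lean`), for `P ≥ 4¹¹` by the analytic estimate
  `RobinAnalyticSharp.mertens_prod_lt_RH` (`RobinAnalyticRH.lean`: Nicolas's (2.18) with the RH-internal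
  Lemma 2.4 of `NicolasLemma24RH.lean`, Schoenfeld's (6.3) as `Schoenfeld1976_theta_holds`, and the certified
  cell covers) together with `σ(N)/N ≤ ∏_{Q<p≤P}(1 − 1/p²)∏_{p≤P}(1 − 1/p)⁻¹`, `log N ≥ θ(P) + θ(Q)`
  (`Nat.ColossallyAbundant.exists_structure`) — the proof of
  `Robin1984_thm1_colossallyAbundant_of_sharp` with the named facts replaced by theorems;
* `Robin1984_thm1_holds` — Robin's Thm. 1 (`Robin1984_thm1_of_colossallyAbundant` with Robin's §3
  Prop. 1, `Robin1984_prop1_holds`, and the numerical range below `55440`);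
* `robin_iff_holds : robin_iff`; `Robin1984_sigma_le_holds`; `lagarias_iff_holds : lagarias_iff`
  (`lagarias_iff_of_Robin1984_sigma_le`).

Trust base: no named fact; `computational` at the gate because `Schoenfeld1976_theta_holds` rests on the
tree's certified first `2000` zeros of `ζ` (`MertensCertificate`, `native_decide`); everything else is
checked by the kernel (prime tables, the colossally abundant chain below `4¹¹`, `ψ − θ` below `2³²`, the
cell covers).

## References

* G. Robin, *Grandes valeurs de la fonction somme des diviseurs et hypothèse de Riemann*, J. Math.
  Pures Appl. 63 (1984), 187–213, Thm. 1, §3, §4 Prop. 1. [Robin1984]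
* J. C. Lagarias, *An elementary problem equivalent to the Riemann hypothesis*, Amer. Math. Monthly
  109 (2002), 534–543, Thm. 1.1. [Lagarias2002]
* J.-L. Nicolas, Acta Arith. 155 (2012), 311–321, (2.18); J. Number Theory 17 (1983), 375–388, Thm. 3.
  [Nicolas2012] [Nicolas1983]
* L. Schoenfeld, Math. Comp. 30 (1976), 337–360, Thm. 10 (6.3). [Schoenfeld1976]
-/

noncomputable section

open Real
open scoped Chebyshev

namespace Literature.NumberTheory.LFunctions

open scoped ArithmeticFunction.sigma in
/-- **The colossally abundant case of Robin's Thm. 1, unconditionally on named facts**: under RH,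
Robin's inequality holds at every colossally abundant `N > 5040`. [cite: Robin1984, §3 (proof of Thm. 1)] -/
theorem Robin1984_thm1_colossallyAbundant_holds : Robin1984_thm1_colossallyAbundant := by
  intro hRH N hCA h5040
  obtain ⟨ε, P, Q, -, -, hP, hPN, -, hQP, hpf, -, -, hσ, hθ, -⟩ := hCA.exists_structure
  by_cases hsmall : P < 4 ^ 11
  · -- all prime factors of `N` are `≤ P < 4¹¹`: the certified chain
    refine robinCA_below_four_pow_eleven N hCA h5040 fun p hp hpN => lt_of_le_of_lt ?_ hsmall
    have hN0 : N ≠ 0 := by omega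
    have : p ∈ N.primeFactors := Nat.mem_primeFactors.2 ⟨hp, hpN, hN0⟩
    rw [hpf] at this
    exact (Nat.mem_primesLE.1 this).1
  · rw [not_lt] at hsmall
    have hlt := RobinAnalyticSharp.mertens_prod_lt_RH hRH hsmall hQP
    have hN0 : N ≠ 0 := by omega
    have hNpos : (0 : ℝ) < N := by exact_mod_cast Nat.pos_of_ne_zero hN0
    have hθpos : 0 < θ P + θ Q := by
      have h1 : 0 < θ (P : ℝ) := Chebyshev.theta_pos (by exact_mod_cast hP.two_le)
      have h2 : 0 ≤ θ (Q : ℝ) := Chebyshev.theta_nonneg _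
      linarith
    have hlog : Real.log (θ P + θ Q) ≤ Real.log (Real.log N) := Real.log_le_log hθpos hθ
    have hlt' : (σ 1 N : ℝ) / N < rexp eulerMascheroniConstant * Real.log (Real.log N) :=
      lt_of_le_of_lt hσ (hlt.trans_le (mul_le_mul_of_nonneg_left hlog (Real.exp_pos _).le))
    unfold robinInequality
    rw [div_lt_iff₀ hNpos] at hlt'
    linarith

/-- **Robin's Theorem 1** (Robin 1984): under RH, `σ(n) < e^γ n log log n` for every `n > 5040`.
[cite: Robin1984, Thm. 1] -/
theorem Robin1984_thm1_holds : Robin1984_thm1 :=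
  Robin1984_thm1_of_colossallyAbundant Robin1984_thm1_colossallyAbundant_holds Robin1984_prop1_holds

/-- **Robin's criterion** (Robin 1984, Thm. 1 and §4 Prop. 1): the named fact `robin_iff` holds —
`RH ⟺ σ(n) < e^γ n log log n` for all `n > 5040`. [cite: Robin1984, Thm. 1 and §4 Prop. 1] -/
theorem robin_iff_holds : robin_iff :=
  robin_iff_iff.2 ⟨Robin1984_thm1_holds,
    robinInequality_imp_riemannHypothesis_of_nicolas Nicolas1983_logf_omega_holds⟩

/-- Robin's Thm. 1 in the non-strict form quoted by Lagarias (Prop. 3.1). [cite: Robin1984, Thm. 1] -/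
theorem Robin1984_sigma_le_holds : Robin1984_sigma_le :=
  Robin1984_sigma_le_of_thm1 Robin1984_thm1_holds

/-- **Lagarias's criterion** (Lagarias 2002, Thm. 1.1): the named fact `lagarias_iff` holds —
`RH ⟺ σ(n) ≤ H_n + exp(H_n) log(H_n)` for all `n ≥ 1`. [cite: Lagarias2002, Thm. 1.1] -/
theorem lagarias_iff_holds : lagarias_iff :=
  lagarias_iff_of_Robin1984_sigma_le Robin1984_sigma_le_holds

end Literature.NumberTheory.LFunctions

end
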